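import Literature.Analysis.FluidPDE.AxisymPoloidalPart
import Literature.Analysis.FluidPDE.SuitableWeak
import Summits.NavierStokesRegularity.OSWSelfSimilar.AxisymAngularVelocityHalfVorticity
import HarnessLib
/-!
# The swirl velocity is controlled by (swirl bound) × (vorticity bound): `u_θ² ≤ ½ ‖Γ‖_∞ ‖ω‖_∞`; under a vorticity rate the
# swirl velocity is TYPE I and every Type-II excess is POLOIDAL (zone Z1 TEMPLATE (I-4)/(I-5) «which component carries the
# singularity», kernel, unconditional)

HONEST FRAMING (cell ns-blowup GROUP B «PROFILE SEARCH», zone Z1 «Type-II log-modulated DSS ansatz for axisymmetric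
Navier–Stokes — the template IS the deliverable»; D-0035/D-0074): part XLI of the Z1 dictionary. Part XL
(`abs_swirlVelocity_le_of_norm_curl_le`: `|u_θ| ≤ ½ Ω r` for an axisymmetric differentiable field with `‖curl u‖ ≤ Ω`)
multiplied by the scale-invariant swirl `Γ = r u_θ` gives a SCALE-INVARIANT bound on the swirl velocity itself:

* `sq_swirlVelocity_le_of_abs_swirl_le_of_norm_curl_le` — `u_θ(x)² ≤ ½ M Ω` whenever `|Γ| ≤ M` and `‖curl u‖ ≤ Ω` on `ℝ³`
  (`u_θ² = (u_θ/r)·Γ`; dimensions: `Γ ~ LU`, `ω ~ U/L`);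
* `norm_sq_le_norm_poloidalPart_sq_add` — hence `‖u(x)‖² ≤ ‖u_pol(x)‖² + ½ M Ω` (`u_pol = poloidalPart u`, the meridional
  part; the cylindrical frame is orthonormal, `norm_poloidalPart_sq`);
* `eventually_sq_swirlVelocity_le_of_vorticityRate` — for a time-dependent family with axisymmetric differentiable slices,
  `|Γ(t, ·)| ≤ M` and the RATE `(T − t)‖curl u(t)‖_∞ ≤ C` near `T⁻`: **`(T − t) u_θ(t, x)² ≤ ½ M C` — THE SWIRL VELOCITY IS
  TYPE I** (in time; in space `r|u_θ| = |Γ| ≤ M` is Type I automatically);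
* `not_poloidal_typeI_of_not_isTypeIBlowup_of_vorticityRate` — **THE TYPE-II EXCESS IS POLOIDAL**: if such a family is NOT
  of Type I at `T` (`¬ IsTypeIBlowup u T`, as KNSS 2009 / Seregin–Šverák 2009 force for every axisymmetric singular
  Leray–Hopf solution, tree `knss_no_axisymmetric_typeI_holds`), then for NO constant `C'` does the poloidal velocity obey
  `‖u_pol(t, x)‖ ≤ C'/√(T − t)` near `T⁻`.

TEMPLATE reading ((I-4)/(I-5), (G1) vs (G2)): under a vorticity certificate the velocity gauge N-a (`λ = ν/‖u‖_∞`, Type-II fast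
by KNSS) is driven by the POLOIDAL components alone; the swirl velocity and the swirl gauge N-b are Type-I-slow. **Nothing here
asserts that a blow-up or a certificate-class witness exists**; pure calculus + bookkeeping of rates. «violates: n/a —
dictionary»; bears_on LADDER-NS N5/Z1 → N1 (crux 8639 certificate class; TEMPLATE (I-4)/(I-5)/(G1)/(G2)). Author:
ns-blowup-profile-eng-1 g10, 2026-08-27.
-/

open Real Filter Topology Set
open Literature.Analysis.FluidPDE

namespace Summit.NavierStokesRegularity.OSWSelfSimilar
namespace TypeIIModulationDictionary

/-! ### `u_θ² ≤ ½ ‖Γ‖_∞ ‖ω‖_∞` -/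

section Pointwise

variable {u : EuclideanSpace ℝ (Fin 3) → EuclideanSpace ℝ (Fin 3)} {M Ω : ℝ}

/-- **`u_θ(x)² ≤ ½ M Ω`** for an axisymmetric differentiable field with `|Γ| ≤ M` and `‖curl u‖ ≤ Ω` on `ℝ³`: off the axis
`u_θ² = |u_θ|·|u_θ| ≤ (½Ωr)·(|Γ|/r) = ½Ω|Γ|` (part XL `abs_swirlVelocity_le_of_norm_curl_le` and `Γ = r u_θ`); on the axis
`u_θ = 0`. [new here — dictionary] -/
theorem sq_swirlVelocity_le_of_abs_swirl_le_of_norm_curl_le (hax : IsAxisymmetric u) (hd : Differentiable ℝ u)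
    (hM : ∀ y, |swirl u y| ≤ M) (hΩ : ∀ y, ‖curl u y‖ ≤ Ω) (x : EuclideanSpace ℝ (Fin 3)) :
    swirlVelocity u x ^ 2 ≤ M * Ω / 2 := by
  have hM0 : 0 ≤ M := (abs_nonneg _).trans (hM x)
  have hΩ0 : 0 ≤ Ω := (norm_nonneg _).trans (hΩ x)
  rcases eq_or_ne (cylRadius x) 0 with hr | hr
  · have : swirlVelocity u x = 0 := by simp [swirlVelocity, eTheta, hr]
    rw [this, zero_pow two_ne_zero]; positivity
  · have hpos : 0 < cylRadius x := lt_of_le_of_ne (cylRadius_nonneg x) (Ne.symm hr)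
    have h1 : |swirlVelocity u x| ≤ Ω / 2 * cylRadius x := abs_swirlVelocity_le_of_norm_curl_le hax hd hΩ x
    have h2 : cylRadius x * |swirlVelocity u x| ≤ M := by
      have h := hM x
      rwa [swirl_eq_cylRadius_mul_swirlVelocity u hr, abs_mul, abs_of_pos hpos] at h
    have h3 : swirlVelocity u x ^ 2 = |swirlVelocity u x| * |swirlVelocity u x| := by rw [← sq, sq_abs]
    rw [h3]
    calc |swirlVelocity u x| * |swirlVelocity u x| ≤ (Ω / 2 * cylRadius x) * |swirlVelocity u x| :=
          mul_le_mul_of_nonneg_right h1 (abs_nonneg _)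
      _ = Ω / 2 * (cylRadius x * |swirlVelocity u x|) := by ring
      _ ≤ Ω / 2 * M := mul_le_mul_of_nonneg_left h2 (by positivity)
      _ = M * Ω / 2 := by ring

/-- **`‖u(x)‖² ≤ ‖u_pol(x)‖² + ½ M Ω`**: under `|Γ| ≤ M`, `‖curl u‖ ≤ Ω` the full velocity exceeds its poloidal (meridional)
part `poloidalPart u` by at most `√(½MΩ)` in quadrature (orthonormal cylindrical frame, `norm_poloidalPart_sq`).
[new here — dictionary] -/
theorem norm_sq_le_norm_poloidalPart_sq_add (hax : IsAxisymmetric u) (hd : Differentiable ℝ u)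
    (hM : ∀ y, |swirl u y| ≤ M) (hΩ : ∀ y, ‖curl u y‖ ≤ Ω) (x : EuclideanSpace ℝ (Fin 3)) :
    ‖u x‖ ^ 2 ≤ ‖poloidalPart u x‖ ^ 2 + M * Ω / 2 := by
  have h := sq_swirlVelocity_le_of_abs_swirl_le_of_norm_curl_le hax hd hM hΩ x
  rcases eq_or_ne (cylRadius x) 0 with hr | hr
  · have h1 : swirlVelocity u x = 0 := by simp [swirlVelocity, eTheta, hr]
    have h2 : poloidalPart u x = u x := by rw [poloidalPart_apply, h1, zero_smul, sub_zero]
    rw [h2]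
    have hM0 : 0 ≤ M := (abs_nonneg _).trans (hM x)
    have hΩ0 : 0 ≤ Ω := (norm_nonneg _).trans (hΩ x)
    linarith [mul_nonneg hM0 hΩ0]
  · rw [norm_poloidalPart_sq u hr]; linarith

end Pointwise

/-! ### Under a vorticity rate: the swirl velocity is Type I, the Type-II excess is poloidal -/

section Rate

variable {T C M : ℝ} {u : ℝ → EuclideanSpace ℝ (Fin 3) → EuclideanSpace ℝ (Fin 3)}

/-- **THE SWIRL VELOCITY IS TYPE I under a vorticity rate.** If the slices `u(t, ·)` are axisymmetric and differentiable
near `T⁻`, with `|Γ(t, ·)| ≤ M` and `(T − t)‖curl u(t, x)‖ ≤ C` there, then `(T − t)·u_θ(t, x)² ≤ ½ M C` for `t` near `T⁻`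
and every `x`. [new here — dictionary] -/
theorem eventually_sq_swirlVelocity_le_of_vorticityRate (hax : ∀ᶠ t in 𝓝[<] T, IsAxisymmetric (u t))
    (hd : ∀ᶠ t in 𝓝[<] T, Differentiable ℝ (u t)) (hM : ∀ᶠ t in 𝓝[<] T, ∀ x, |swirl (u t) x| ≤ M)
    (hrate : ∀ᶠ t in 𝓝[<] T, ∀ x, (T - t) * ‖curl (u t) x‖ ≤ C) :
    ∀ᶠ t in 𝓝[<] T, ∀ x, (T - t) * swirlVelocity (u t) x ^ 2 ≤ M * C / 2 := by
  have hlt : ∀ᶠ t in 𝓝[<] T, t < T := eventually_mem_nhdsWithin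
  filter_upwards [hax, hd, hM, hrate, hlt] with t hax' hd' hM' hrate' hlt'
  intro x
  have hTt : 0 < T - t := sub_pos.2 hlt'
  have hΩ : ∀ y, ‖curl (u t) y‖ ≤ C / (T - t) := fun y => by
    rw [le_div_iff₀ hTt, mul_comm]; exact hrate' y
  have h := sq_swirlVelocity_le_of_abs_swirl_le_of_norm_curl_le hax' hd' hM' hΩ x
  calc (T - t) * swirlVelocity (u t) x ^ 2 ≤ (T - t) * (M * (C / (T - t)) / 2) :=
        mul_le_mul_of_nonneg_left h hTt.le
    _ = M * C / 2 := by field_simp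

/-- **THE TYPE-II EXCESS IS POLOIDAL.** Under the hypotheses of `eventually_sq_swirlVelocity_le_of_vorticityRate`, if the
family is NOT of Type I at `T` (`¬ IsTypeIBlowup u T`: no `C'` with `‖u(t, x)‖ ≤ C'/√(T − t)` near `T⁻` — what KNSS 2009 /
Seregin–Šverák 2009 force for axisymmetric singular Leray–Hopf solutions), then the POLOIDAL velocity `u_pol = poloidalPart u`
is not of Type I either: for every `C'`, the bound `‖u_pol(t, x)‖ ≤ C'/√(T − t)` fails frequently as `t ↑ T`
(`‖u‖² ≤ ‖u_pol‖² + ½MC/(T − t)`). [new here — dictionary] -/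
theorem not_poloidal_typeI_of_not_isTypeIBlowup_of_vorticityRate (hax : ∀ᶠ t in 𝓝[<] T, IsAxisymmetric (u t))
    (hd : ∀ᶠ t in 𝓝[<] T, Differentiable ℝ (u t)) (hM : ∀ᶠ t in 𝓝[<] T, ∀ x, |swirl (u t) x| ≤ M)
    (hrate : ∀ᶠ t in 𝓝[<] T, ∀ x, (T - t) * ‖curl (u t) x‖ ≤ C) (hII : ¬ IsTypeIBlowup u T) (C' : ℝ) :
    ¬ ∀ᶠ t in 𝓝[<] T, ∀ x, ‖poloidalPart (u t) x‖ ≤ C' / Real.sqrt (T - t) := by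
  intro hpol
  apply hII
  refine ⟨Real.sqrt (C' ^ 2 + |M * C| / 2), ?_⟩
  have hlt : ∀ᶠ t in 𝓝[<] T, t < T := eventually_mem_nhdsWithin
  filter_upwards [hax, hd, hM, hrate, hlt, hpol] with t hax' hd' hM' hrate' hlt' hpol'
  intro x
  have hTt : 0 < T - t := sub_pos.2 hlt'
  have hsq : 0 < Real.sqrt (T - t) := Real.sqrt_pos.2 hTt
  have hΩ : ∀ y, ‖curl (u t) y‖ ≤ C / (T - t) := fun y => by
    rw [le_div_iff₀ hTt, mul_comm]; exact hrate' y
  have h1 := norm_sq_le_norm_poloidalPart_sq_add hax' hd' hM' hΩ x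
  have h2 : ‖poloidalPart (u t) x‖ ^ 2 ≤ C' ^ 2 / (T - t) := by
    have hp := hpol' x
    have hC' : 0 ≤ C' / Real.sqrt (T - t) := (norm_nonneg _).trans hp
    calc ‖poloidalPart (u t) x‖ ^ 2 ≤ (C' / Real.sqrt (T - t)) ^ 2 := pow_le_pow_left₀ (norm_nonneg _) hp 2
      _ = C' ^ 2 / (T - t) := by rw [div_pow, Real.sq_sqrt hTt.le]
  have h3 : M * (C / (T - t)) / 2 ≤ |M * C| / 2 / (T - t) := by
    rw [show M * (C / (T - t)) / 2 = (M * C / 2) / (T - t) by ring]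
    exact div_le_div_of_nonneg_right (by linarith [le_abs_self (M * C)]) hTt.le
  have h4 : ‖u t x‖ ^ 2 ≤ (C' ^ 2 + |M * C| / 2) / (T - t) := by
    calc ‖u t x‖ ^ 2 ≤ ‖poloidalPart (u t) x‖ ^ 2 + M * (C / (T - t)) / 2 := h1
      _ ≤ C' ^ 2 / (T - t) + |M * C| / 2 / (T - t) := add_le_add h2 h3
      _ = (C' ^ 2 + |M * C| / 2) / (T - t) := by ring
  have hK : 0 ≤ C' ^ 2 + |M * C| / 2 := by positivity
  have h5 : ‖u t x‖ ^ 2 ≤ (Real.sqrt (C' ^ 2 + |M * C| / 2) / Real.sqrt (T - t)) ^ 2 := by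
    rw [div_pow, Real.sq_sqrt hK, Real.sq_sqrt hTt.le]; exact h4
  exact (pow_le_pow_iff_left₀ (norm_nonneg _) (by positivity) two_ne_zero).1 h5

end Rate

end TypeIIModulationDictionary
end Summit.NavierStokesRegularity.OSWSelfSimilar
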